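import Mathlib
import Summits.AtomisticToContinuum.Crystallization.Theses.ReggeStarCoercivity
import Literature.Geometry.DiscreteGeometry.SolidAngleFraction
import Literature.Geometry.DiscreteGeometry.DihedralAngleFraction
import Literature.Geometry.DiscreteGeometry.ConeTiling

/-!
# `DihedralFlatness` — the dihedral-angle partition of unity around an edge (Regge flatness)

Item `stmt-AtomisticToContinuum-13608` of route `ReggeStarCoercivity` (support, edge form of
flatness; Regge 1961: zero deficit angle at an interior edge of a triangulation of flat `ℝ³`;
Coxeter 1958: froth sharing of a bond among the simplices around it).

For tetrahedra `T_k = conv{v, w, p k 0, p k 1}` sharing the edge `vw`, non-degenerate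
(`w − v, p k 0 − v, p k 1 − v` linearly independent) and with pairwise disjoint interiors, the
unit-ball volume fractions at `v` of the dihedral wedges
`W_k = {v + s (w − v) + c₀ (p k 0 − v) + c₁ (p k 1 − v) : s ∈ ℝ, cᵢ ≥ 0}`
(`= dihedral angle / 2π`, `Literature.Geometry.DiscreteGeometry.dihedralFraction`) sum to `≤ 1`,
with equality when the tetrahedra cover a neighbourhood of the midpoint `m` of `vw`.

PROOF (pure measure theory, in the vocabulary of `SolidAngleFraction.lean` / `ConeTiling.lean`;
the summands of the item are `ballFraction v (apexWedge v (w − v) (p k · − v))` by `rfl`).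
* `dihedralFlat_smul_mem`: a wedge is mapped into itself by `x ↦ v + s₀ (w − v) + t (x − v)`
  (`t ≥ 0`): translation along the edge and dilation about the apex.
* `dihedralFlat_local`: near the midpoint the wedge lies inside its tetrahedron — decomposing
  `q − m` in the basis `w − v, p 0 − v, p 1 − v` (continuity of the coordinate map
  `Basis.equivFunL`) the coordinates of a wedge point `q` with `dist q m < ρ` are
  `s ∈ (3/8, 5/8)`, `0 ≤ cᵢ ≤ 1/8`, an explicit convex combination of the four vertices.
* `dihedralFlat_volume_inter`: two such wedges whose tetrahedra have disjoint interiors meet in a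
  null set — their intersection is convex, and if it had an interior point `q` the image of a
  small ball around `q` under `x ↦ m + t (x − v)` (`t` small) would be an open set inside both
  wedges and inside `ball m ρ`, hence inside both tetrahedron interiors; so the interior is empty
  and a convex set with empty interior is null (`Convex.addHaar_frontier`).
* `dihedralFlat_cover`: if the tetrahedra cover `ball m r` then the wedges cover `ℝ³`
  (shrink `x` towards `m`, land in some `T_k ⊆ W_k`, pull back with `dihedralFlat_smul_mem`).
* `ConeTiling.sum_ballFraction_le_one` / `sum_ballFraction_eq_one_of_ball_subset` finish.
-/

noncomputable section

namespace Summit.AtomisticToContinuum.Crystallization.Theorems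

open Literature.Geometry.DiscreteGeometry
open MeasureTheory Metric Set

local notation "E3" => EuclideanSpace ℝ (Fin 3)

/-- Affine self-maps of a wedge: for `q ∈ apexWedge v d u`, `s₀ ∈ ℝ` and `t ≥ 0` the point
`v + s₀ • d + t • (q − v)` (dilate about the apex, translate along the edge) is again in the
wedge. -/
theorem dihedralFlat_smul_mem {V : Type*} [AddCommGroup V] [Module ℝ V] {ι : Type*} [Fintype ι]
    {v d : V} {u : ι → V} {q : V} (hq : q ∈ apexWedge v d u) (s₀ : ℝ) {t : ℝ} (ht : 0 ≤ t) :
    v + s₀ • d + t • (q - v) ∈ apexWedge v d u := by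
  obtain ⟨s, c, hc, rfl⟩ := hq
  refine ⟨s₀ + t * s, fun i => t * c i, fun i => mul_nonneg ht (hc i), ?_⟩
  have e : v + s • d + ∑ i, c i • u i - v = s • d + ∑ i, c i • u i := by abel
  rw [e, smul_add, Finset.smul_sum, smul_smul, add_smul]
  simp only [smul_smul]
  abel

/-- A wedge `apexWedge v d u` is convex. -/
theorem dihedralFlat_convex {V : Type*} [AddCommGroup V] [Module ℝ V] {ι : Type*} [Fintype ι]
    (v d : V) (u : ι → V) : Convex ℝ (apexWedge v d u) := by
  rintro _ ⟨s₁, c₁, hc₁, rfl⟩ _ ⟨s₂, c₂, hc₂, rfl⟩ a b ha hb hab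
  refine ⟨a * s₁ + b * s₂, fun i => a * c₁ i + b * c₂ i,
    fun i => add_nonneg (mul_nonneg ha (hc₁ i)) (mul_nonneg hb (hc₂ i)), ?_⟩
  calc a • (v + s₁ • d + ∑ i, c₁ i • u i) + b • (v + s₂ • d + ∑ i, c₂ i • u i)
      = (a + b) • v + ((a * s₁ + b * s₂) • d + ∑ i, (a * c₁ i + b * c₂ i) • u i) := by
        simp only [smul_add, Finset.smul_sum, smul_smul, add_smul, Finset.sum_add_distrib]
        abel
    _ = v + (a * s₁ + b * s₂) • d + ∑ i, (a * c₁ i + b * c₂ i) • u i := by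
        rw [hab, one_smul, add_assoc]

/-- The tetrahedron `conv{v, w, p 0, p 1}` lies in the wedge at `v` along the edge `vw` spanned
by `p 0 − v`, `p 1 − v`. -/
theorem dihedralFlat_hull_subset (v w : E3) (p : Fin 2 → E3) :
    convexHull ℝ ({v, w} ∪ range p) ⊆ apexWedge v (w - v) (fun i => p i - v) := by
  refine convexHull_min ?_ (dihedralFlat_convex v (w - v) _)
  rintro x (hx | ⟨i, rfl⟩)
  · rcases (mem_insert_iff.1 hx) with rfl | hx
    · exact self_mem_apexWedge _ _ _
    · rw [mem_singleton_iff] at hx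
      subst hx
      exact ⟨1, 0, fun _ => le_rfl, by simp⟩
  · have h := apexCone_subset_apexWedge v (w - v) (fun i => p i - v)
      (add_mem_apexCone v (fun i => p i - v) i)
    simpa using h

/-- **Near the midpoint of the edge the wedge is inside the tetrahedron**: for a non-degenerate
tetrahedron there is `ρ > 0` such that every point of the wedge within `ρ` of
`m = v + ½ (w − v)` lies in `conv{v, w, p 0, p 1}`. -/
theorem dihedralFlat_local {v w : E3} {p : Fin 2 → E3}
    (hli : LinearIndependent ℝ ![w - v, p 0 - v, p 1 - v]) :
    ∃ ρ : ℝ, 0 < ρ ∧ ∀ q ∈ apexWedge v (w - v) (fun i => p i - v),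
      dist q (v + (1 / 2 : ℝ) • (w - v)) < ρ → q ∈ convexHull ℝ ({v, w} ∪ range p) := by
  have hcard : Fintype.card (Fin 3) = Module.finrank ℝ E3 := by simp
  set B := basisOfLinearIndependentOfCardEqFinrank hli hcard with hB
  have hBv : ∀ i, B i = ![w - v, p 0 - v, p 1 - v] i := fun i => by
    rw [hB, coe_basisOfLinearIndependentOfCardEqFinrank]
  have hB0 : B 0 = w - v := by rw [hBv]; rfl
  have hB1 : B 1 = p 0 - v := by rw [hBv]; rfl
  have hB2 : B 2 = p 1 - v := by rw [hBv]; rfl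
  set f : E3 →L[ℝ] (Fin 3 → ℝ) := (B.equivFunL : E3 →L[ℝ] (Fin 3 → ℝ)) with hf
  have hfy : ∀ y, f y = B.equivFun y := fun y => rfl
  obtain ⟨C, hC0, hC⟩ := f.bound
  refine ⟨1 / (8 * C), by positivity, ?_⟩
  rintro q ⟨s, c, hc, rfl⟩ hdist
  -- coordinates of `q - m` in the basis `B`
  set x : Fin 3 → ℝ := ![s - 1 / 2, c 0, c 1] with hx
  have hx0 : x 0 = s - 1 / 2 := rfl
  have hx1 : x 1 = c 0 := rfl
  have hx2 : x 2 = c 1 := rfl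
  have hqm : v + s • (w - v) + ∑ i, c i • (p i - v) - (v + (1 / 2 : ℝ) • (w - v)) =
      ∑ i, x i • B i := by
    simp only [Fin.sum_univ_two, Fin.sum_univ_three, hB0, hB1, hB2, hx0, hx1, hx2]
    module
  have hfx : f (∑ i, x i • B i) = x := by
    rw [hfy, ← B.equivFun_symm_apply]
    exact B.equivFun.apply_symm_apply x
  have hxn : ‖x‖ ≤ 1 / 8 := by
    have h1 : ‖x‖ ≤ C * ‖∑ i, x i • B i‖ := by simpa only [hfx] using hC (∑ i, x i • B i)
    rw [← hqm, ← dist_eq_norm] at h1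
    calc ‖x‖ ≤ C * _ := h1
      _ ≤ C * (1 / (8 * C)) := mul_le_mul_of_nonneg_left hdist.le hC0.le
      _ = 1 / 8 := by field_simp
  have h0 : |s - 1 / 2| ≤ 1 / 8 := by
    have := (norm_le_pi_norm x 0).trans hxn
    rwa [hx0, Real.norm_eq_abs] at this
  have h1 : |c 0| ≤ 1 / 8 := by
    have := (norm_le_pi_norm x 1).trans hxn
    rwa [hx1, Real.norm_eq_abs] at this
  have h2 : |c 1| ≤ 1 / 8 := by
    have := (norm_le_pi_norm x 2).trans hxn
    rwa [hx2, Real.norm_eq_abs] at this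
  obtain ⟨h0a, h0b⟩ := abs_le.1 h0
  obtain ⟨h1a, h1b⟩ := abs_le.1 h1
  obtain ⟨h2a, h2b⟩ := abs_le.1 h2
  have hc0 := hc 0
  have hc1 := hc 1
  -- an explicit convex combination of the four vertices
  refine mem_convexHull_of_exists_fintype (ι := Fin 4) ![1 - s - c 0 - c 1, s, c 0, c 1]
    ![v, w, p 0, p 1] ?_ ?_ ?_ ?_
  · intro i
    fin_cases i
    · show 0 ≤ 1 - s - c 0 - c 1
      linarith
    · show 0 ≤ s
      linarith
    · exact hc0
    · exact hc1
  · simp only [Fin.sum_univ_four]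
    show 1 - s - c 0 - c 1 + s + c 0 + c 1 = 1
    ring
  · intro i
    fin_cases i
    · exact Or.inl (mem_insert _ _)
    · exact Or.inl (mem_insert_of_mem _ (mem_singleton _))
    · exact Or.inr ⟨0, rfl⟩
    · exact Or.inr ⟨1, rfl⟩
  · simp only [Fin.sum_univ_four, Fin.sum_univ_two]
    show (1 - s - c 0 - c 1) • v + s • w + c 0 • p 0 + c 1 • p 1 =
      v + s • (w - v) + (c 0 • (p 0 - v) + c 1 • (p 1 - v))
    module

/-- **Two wedges whose tetrahedra have disjoint interiors meet in a null set.** -/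
theorem dihedralFlat_volume_inter {v w : E3} {p₁ p₂ : Fin 2 → E3}
    (h₁ : LinearIndependent ℝ ![w - v, p₁ 0 - v, p₁ 1 - v])
    (h₂ : LinearIndependent ℝ ![w - v, p₂ 0 - v, p₂ 1 - v])
    (hdisj : interior (convexHull ℝ ({v, w} ∪ range p₁)) ∩
      interior (convexHull ℝ ({v, w} ∪ range p₂)) = ∅) :
    volume (apexWedge v (w - v) (fun i => p₁ i - v) ∩ apexWedge v (w - v) (fun i => p₂ i - v)) = 0 := by
  set m : E3 := v + (1 / 2 : ℝ) • (w - v) with hm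
  obtain ⟨ρ₁, hρ₁, hloc₁⟩ := dihedralFlat_local h₁
  obtain ⟨ρ₂, hρ₂, hloc₂⟩ := dihedralFlat_local h₂
  set W₁ := apexWedge v (w - v) (fun i => p₁ i - v) with hW₁
  set W₂ := apexWedge v (w - v) (fun i => p₂ i - v) with hW₂
  have hconv : Convex ℝ (W₁ ∩ W₂) :=
    (dihedralFlat_convex v (w - v) _).inter (dihedralFlat_convex v (w - v) _)
  have hint : interior (W₁ ∩ W₂) = ∅ := by
    rw [← Set.not_nonempty_iff_eq_empty]
    rintro ⟨q, hq⟩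
    rw [mem_interior_iff_mem_nhds, Metric.mem_nhds_iff] at hq
    obtain ⟨δ, hδ, hball⟩ := hq
    set R : ℝ := dist q v + δ with hR
    have hRpos : 0 < R := by positivity
    set t : ℝ := min ρ₁ ρ₂ / (2 * R) with ht
    have hmin : 0 < min ρ₁ ρ₂ := lt_min hρ₁ hρ₂
    have htpos : 0 < t := by positivity
    set ψ : E3 → E3 := fun x => m + t • (x - v) with hψ
    have hopen : IsOpen (ψ '' ball q δ) :=
      ((isOpenMap_add_left m).comp ((isOpenMap_smul₀ htpos.ne').comp (isOpenMap_sub_right v)))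
        _ isOpen_ball
    -- `ψ` maps the ball into both wedges …
    have hψ₁ : ∀ x ∈ ball q δ, ψ x ∈ W₁ := fun x hx =>
      dihedralFlat_smul_mem (hball hx).1 (1 / 2) htpos.le
    have hψ₂ : ∀ x ∈ ball q δ, ψ x ∈ W₂ := fun x hx =>
      dihedralFlat_smul_mem (hball hx).2 (1 / 2) htpos.le
    -- … and close to the midpoint
    have hψm : ∀ x ∈ ball q δ, dist (ψ x) m < min ρ₁ ρ₂ := by
      intro x hx
      have hxv : ‖x - v‖ < R := by
        calc ‖x - v‖ = dist x v := (dist_eq_norm x v).symm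
          _ ≤ dist x q + dist q v := dist_triangle _ _ _
          _ < δ + dist q v := by gcongr; exact mem_ball.1 hx
          _ = R := by rw [hR, add_comm]
      have e : dist (ψ x) m = t * ‖x - v‖ := by
        rw [hψ, dist_eq_norm]
        simp only [add_sub_cancel_left, norm_smul, Real.norm_of_nonneg htpos.le]
      rw [e]
      calc t * ‖x - v‖ ≤ t * R := mul_le_mul_of_nonneg_left hxv.le htpos.le
        _ = min ρ₁ ρ₂ / 2 := by rw [ht]; field_simp
        _ < min ρ₁ ρ₂ := by linarith
    have hT₁ : ψ '' ball q δ ⊆ interior (convexHull ℝ ({v, w} ∪ range p₁)) := by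
      refine interior_maximal ?_ hopen
      rintro _ ⟨x, hx, rfl⟩
      exact hloc₁ _ (hψ₁ x hx) ((hψm x hx).trans_le (min_le_left _ _))
    have hT₂ : ψ '' ball q δ ⊆ interior (convexHull ℝ ({v, w} ∪ range p₂)) := by
      refine interior_maximal ?_ hopen
      rintro _ ⟨x, hx, rfl⟩
      exact hloc₂ _ (hψ₂ x hx) ((hψm x hx).trans_le (min_le_right _ _))
    have hmem : ψ q ∈ interior (convexHull ℝ ({v, w} ∪ range p₁)) ∩
        interior (convexHull ℝ ({v, w} ∪ range p₂)) :=
      ⟨hT₁ ⟨q, mem_ball_self hδ, rfl⟩, hT₂ ⟨q, mem_ball_self hδ, rfl⟩⟩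
    rw [hdisj] at hmem
    simp at hmem
  have hsub : W₁ ∩ W₂ ⊆ frontier (W₁ ∩ W₂) := by
    intro x hx
    rw [frontier, hint, Set.sdiff_empty]
    exact subset_closure hx
  exact measure_mono_null hsub (hconv.addHaar_frontier volume)

/-- **If the tetrahedra cover a ball around the midpoint of the edge, the wedges cover space.** -/
theorem dihedralFlat_cover {n : ℕ} {v w : E3} {p : Fin n → Fin 2 → E3} {r : ℝ} (hr : 0 < r)
    (hcover : ball (midpoint ℝ v w) r ⊆ ⋃ k, convexHull ℝ ({v, w} ∪ range (p k))) (x : E3) :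
    ∃ k, x ∈ apexWedge v (w - v) (fun i => p k i - v) := by
  have hm : midpoint ℝ v w = v + (1 / 2 : ℝ) • (w - v) := by
    rw [midpoint_eq_smul_add ℝ v w, invOf_eq_inv]
    module
  set L : ℝ := ‖x - v‖ + 1 with hL
  have hLpos : 0 < L := by positivity
  set t : ℝ := r / (2 * L) with ht
  have htpos : 0 < t := by positivity
  set y : E3 := midpoint ℝ v w + t • (x - v) with hy
  have hyball : y ∈ ball (midpoint ℝ v w) r := by
    rw [mem_ball, dist_eq_norm, hy, add_sub_cancel_left, norm_smul, Real.norm_of_nonneg htpos.le]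
    calc t * ‖x - v‖ ≤ t * L := mul_le_mul_of_nonneg_left (by rw [hL]; linarith) htpos.le
      _ = r / 2 := by rw [ht]; field_simp
      _ < r := by linarith
  obtain ⟨k, hk⟩ := mem_iUnion.1 (hcover hyball)
  refine ⟨k, ?_⟩
  have hyW := dihedralFlat_hull_subset v w (p k) hk
  have key := dihedralFlat_smul_mem hyW (-(t⁻¹ * (1 / 2))) (inv_nonneg.2 htpos.le)
  have h1 : t⁻¹ * t = 1 := inv_mul_cancel₀ htpos.ne'
  convert key using 1
  rw [hy, hm]
  linear_combination (norm := module) h1.symm • (x - v)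

/-- **`DihedralFlatness`** (item `stmt-AtomisticToContinuum-13608`): the dihedral-angle volume
fractions at `v` of non-degenerate tetrahedra around a common edge `vw` with pairwise disjoint
interiors sum to at most `1`, and to exactly `1` when the tetrahedra cover a neighbourhood of the
midpoint of the edge (Regge: zero deficit angle at an interior edge of a flat triangulation). -/
theorem dihedralFlatness_proof : Theses.ReggeStarCoercivity.DihedralFlatness := by
  intro n v w p hli hdisj
  have key : ∀ k, (volume (Metric.ball v 1 ∩ {q | ∃ s : ℝ, ∃ c : Fin 2 → ℝ, (∀ i, 0 ≤ c i) ∧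
      q = v + s • (w - v) + ∑ i, c i • (p k i - v)})).toReal /
        (volume (Metric.ball v (1 : ℝ))).toReal =
      ballFraction v (apexWedge v (w - v) (fun i => p k i - v)) := fun k => rfl
  simp only [key]
  have hS : ∀ k ∈ (Finset.univ : Finset (Fin n)),
      MeasurableSet (apexWedge v (w - v) (fun i => p k i - v)) := by
    intro k _
    rw [apexWedge_eq_inter_halfspaces v w (fun i => p k i - v) (hli k)]
    exact (isClosed_le continuous_const (by fun_prop)).measurableSet.inter
      (isClosed_le continuous_const (by fun_prop)).measurableSet
  have hnull : ((Finset.univ : Finset (Fin n)) : Set (Fin n)).Pairwise fun k l =>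
      volume (apexWedge v (w - v) (fun i => p k i - v) ∩
        apexWedge v (w - v) (fun i => p l i - v)) = 0 :=
    fun k _ l _ hkl => dihedralFlat_volume_inter (hli k) (hli l) (hdisj k l hkl)
  refine ⟨sum_ballFraction_le_one Finset.univ v hS hnull, ?_⟩
  rintro ⟨r, hr, hcover⟩
  refine sum_ballFraction_eq_one_of_ball_subset Finset.univ v hS hnull ?_
  intro x _
  obtain ⟨k, hk⟩ := dihedralFlat_cover hr hcover x
  exact mem_iUnion₂.2 ⟨k, Finset.mem_univ k, hk⟩

end Summit.AtomisticToContinuum.Crystallization.Theorems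

end
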